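import Mathlib
import Literature.NumberTheory.LFunctions.Zhang2022.KappaLSeries
import HarnessLib

/-!
# Zhang (2022) §7: the splitting `l = hr` and the local Euler factors of `κ` (for node `Z22:§7.u045`)

Topic `Literature/NumberTheory/LFunctions/Zhang2022` (Landau–Siegel audit tree; verdict-neutral).
Y. Zhang, *Discrete mean estimates and the Landau–Siegel zero*, arXiv:2211.02515v1 (2022)
[Zhang2022LandauSiegel] — **an unrefereed manuscript under adjudication.** Cell siegel-zhang
(D-0069), discharge of the proof-internal step `Z22:§7.u045` of Proposition 7.1 (c) (§7 p. 40,
tex L2100–L2102):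

> Every `l` with `(l, d₂k) = 1` can be uniquely written as `l = hr` such that `h ∈ 𝔫(d₁)`,
> `(h, d₂k) = 1` and `(r, d₁d₂k) = 1`. Hence
> `Σ_{(l,kd₂)=1} κ(d₁l) l^{−s} = κ̃(d₁;d₂k,s) λ(d₁d₂k,s) ζ(s+β₁)ζ(s+β₂)ζ(s+β₃)/ζ(s)`.

This file carries the two elementary ingredients; the companion `Section7KappaEuler.lean` assembles
them into `Section7dStatements.step7u045_holds`. Theorems only, no new definitions:

* §1 *the splitting*: for a finite set `S` of primes every `l ≥ 1` is uniquely `a·b` with `a`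
  `S`-factored (Mathlib's `Nat.factoredNumbers S`; Zhang's `𝔫(d)` is the case `S = primeFactors d`)
  and `b` free of the primes of `S` (`exists_split`, `split_unique`; the parts are
  `∏_{q∈S} q^{v_q(l)}` and `∏_{q∉S} q^{v_q(l)}` via `Nat.factorization`);
* §2: hence a Dirichlet convolution of an `S`-supported and an `S`-free sequence has a single term
  at each `l` (`convolution_eq_of_split`);
* §3 *local factors*: at a prime `q` the local series `Σ_e f(q^e)x^e` of a Dirichlet convolution is
  the Cauchy product of the local series (`tsum_prime_pow_mul`), whence for the tree's
  `κ = n^{−ib₁} ∗ n^{−ib₂} ∗ n^{−ib₃} ∗ μ` (`MeanSquareMajorant.kappa`, the arithmetic function with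
  `Σκ(n)n^{−s} = ζ(s+ib₁)ζ(s+ib₂)ζ(s+ib₃)/ζ(s)`, §7 p. 34):
  `Σ_e κ(q^e)x^e = (1 − x)/((1 − q^{−ib₁}x)(1 − q^{−ib₂}x)(1 − q^{−ib₃}x))` for `‖x‖ < 1`
  (`tsum_prime_pow_kappa`) — the reciprocal of the local factor of Zhang's `λ(m,s)` at `x = q^{−s}`.

WHAT THIS IS NOT: any statement about Theorems 1–2 of the manuscript or about Landau–Siegel zeros;
not yet the node itself (see the companion file).

## References

* Y. Zhang, arXiv:2211.02515v1 (2022), §7 p. 32 (`𝔫`, `κ̃`, `λ`), p. 34 (`κ`), p. 40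
  (the display after (7.19)), tex L1789–L1797, L1868, L2100–L2102. [cite: Zhang2022LandauSiegel, §7 p.40]
* E. C. Titchmarsh, *The Theory of the Riemann Zeta-Function*, 2nd ed. (1986), §1.1 (Euler
  products, `Σμ(n)n^{−s} = 1/ζ(s)`). [cite: Titchmarsh1986, §1.1]
-/

noncomputable section

open Complex LSeries ArithmeticFunction Finset
open scoped LSeries.notation

namespace Literature.NumberTheory.LFunctions.Zhang2022.KappaEuler


/-! ### §1. Splitting `l = h·r` along a finite set of primes

For a finite set `S` of primes and `l ≥ 1` the splitting is `l = a·b` with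
`a = ∏_{q ∈ S} q^{v_q(l)}` (`= (l.factorization.filter (· ∈ S)).prod (· ^ ·)`, an `S`-factored
number) and `b = ∏_{q ∉ S} q^{v_q(l)}` (free of the primes of `S`). No new definitions are
introduced: the two parts appear through their defining expressions, and downstream only the
existence-and-uniqueness statements `exists_split` / `split_unique` are used. -/

variable {S : Finset ℕ} {l : ℕ}

/-- Members of the support of a filtered factorization are primes. [folklore] -/
private theorem prime_of_mem_support_filter {P : ℕ → Prop} [DecidablePred P] {p : ℕ}
    (hp : p ∈ (l.factorization.filter P).support) : p.Prime := by
  rw [Finsupp.support_filter, Finset.mem_filter, Nat.support_factorization] at hp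
  exact Nat.prime_of_mem_primeFactors hp.1

/-- The factorization of a filtered part `∏_{P q} q^{v_q(l)}` is the filtered factorization.
[folklore] -/
private theorem factorization_filterPart (P : ℕ → Prop) [DecidablePred P] (l : ℕ) :
    ((l.factorization.filter P).prod (· ^ ·)).factorization = l.factorization.filter P :=
  Nat.prod_pow_factorization_eq_self fun _ hp => prime_of_mem_support_filter hp

/-- A filtered part `∏_{P q} q^{v_q(l)}` is positive. [folklore] -/
private theorem filterPart_pos (P : ℕ → Prop) [DecidablePred P] (l : ℕ) :
    0 < (l.factorization.filter P).prod (· ^ ·) := by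
  unfold Finsupp.prod
  exact Finset.prod_pos fun p hp => pow_pos (prime_of_mem_support_filter hp).pos _

/-- `l = (S-part) · (S-free part)` for `l ≠ 0`. [folklore] -/
private theorem sPart_mul_cPart (S : Finset ℕ) (hl : l ≠ 0) :
    (l.factorization.filter (· ∈ S)).prod (· ^ ·) * (l.factorization.filter (· ∉ S)).prod (· ^ ·)
      = l := by
  refine Nat.eq_of_factorization_eq
    (mul_ne_zero (filterPart_pos _ l).ne' (filterPart_pos _ l).ne') hl fun p => ?_
  rw [Nat.factorization_mul (filterPart_pos _ l).ne' (filterPart_pos _ l).ne',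
    factorization_filterPart, factorization_filterPart, Finsupp.filter_add_filter_not]

/-- The `S`-part is an `S`-factored number. [folklore] -/
private theorem sPart_mem_factoredNumbers (S : Finset ℕ) (l : ℕ) :
    (l.factorization.filter (· ∈ S)).prod (· ^ ·) ∈ Nat.factoredNumbers S := by
  refine Nat.mem_factoredNumbers'.mpr fun p hp hdvd => ?_
  have h1 : 1 ≤ ((l.factorization.filter (· ∈ S)).prod (· ^ ·)).factorization p :=
    (hp.dvd_iff_one_le_factorization (filterPart_pos _ l).ne').mp hdvd
  rw [factorization_filterPart, Finsupp.filter_apply] at h1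
  by_contra hpS
  rw [if_neg hpS] at h1
  exact Nat.not_succ_le_zero 0 h1

/-- No prime of `S` divides the `S`-free part. [folklore] -/
private theorem not_dvd_cPart {q : ℕ} (hq : q ∈ S) (hqp : q.Prime) :
    ¬ q ∣ (l.factorization.filter (· ∉ S)).prod (· ^ ·) := by
  intro h
  have h1 : 1 ≤ ((l.factorization.filter (· ∉ S)).prod (· ^ ·)).factorization q :=
    (hqp.dvd_iff_one_le_factorization (filterPart_pos _ l).ne').mp h
  rw [factorization_filterPart, Finsupp.filter_apply, if_neg (not_not.mpr hq)] at h1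
  exact Nat.not_succ_le_zero 0 h1

/-- **Existence of the splitting** ("every `l` … can be written as `l = hr` with `h ∈ 𝔫(d₁)` …
and `(r, d₁…) = 1`", §7 p. 40): every `l ≥ 1` is `a·b` with `a` an `S`-factored number and `b`
free of the primes of `S`. [cite: Zhang2022LandauSiegel, §7 p.40, tex L2100] -/
theorem exists_split (S : Finset ℕ) (hl : l ≠ 0) :
    ∃ a b : ℕ, a * b = l ∧ a ∈ Nat.factoredNumbers S ∧ ∀ q ∈ S, q.Prime → ¬ q ∣ b :=
  ⟨_, _, sPart_mul_cPart S hl, sPart_mem_factoredNumbers S l, fun _ hq hqp => not_dvd_cPart hq hqp⟩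

/-- The factor `a` of any splitting has factorization `v_q(a) = v_q(l)·𝟙[q ∈ S]`. [folklore] -/
private theorem factorization_eq_of_split (hl : l ≠ 0) {a b : ℕ} (hab : a * b = l)
    (ha : a ∈ Nat.factoredNumbers S) (hb : ∀ q ∈ S, q.Prime → ¬ q ∣ b) :
    a.factorization = l.factorization.filter (· ∈ S) := by
  have ha0 : a ≠ 0 := by rintro rfl; exact hl (by rw [← hab, zero_mul])
  have hb0 : b ≠ 0 := by rintro rfl; exact hl (by rw [← hab, mul_zero])
  have hfac : l.factorization = a.factorization + b.factorization := by
    rw [← hab, Nat.factorization_mul ha0 hb0]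
  ext p
  rw [Finsupp.filter_apply, hfac, Finsupp.add_apply]
  by_cases hpS : p ∈ S
  · rw [if_pos hpS]
    have hbp : b.factorization p = 0 := by
      rw [Nat.factorization_eq_zero_iff]
      by_cases hpp : p.Prime
      · exact Or.inr (Or.inl (hb p hpS hpp))
      · exact Or.inl hpp
    rw [hbp, add_zero]
  · rw [if_neg hpS, Nat.factorization_eq_zero_iff]
    by_contra hcon
    push Not at hcon
    exact hpS (Nat.mem_factoredNumbers'.mp ha p hcon.1 hcon.2.1)

/-- **Uniqueness of the splitting** ("… can be uniquely written as …", §7 p. 40): two splittings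
of the same `l ≥ 1` coincide. [cite: Zhang2022LandauSiegel, §7 p.40, tex L2100] -/
theorem split_unique (hl : l ≠ 0) {a b a' b' : ℕ} (hab : a * b = l)
    (ha : a ∈ Nat.factoredNumbers S) (hb : ∀ q ∈ S, q.Prime → ¬ q ∣ b) (hab' : a' * b' = l)
    (ha' : a' ∈ Nat.factoredNumbers S) (hb' : ∀ q ∈ S, q.Prime → ¬ q ∣ b') :
    a = a' ∧ b = b' := by
  have ha0 : a ≠ 0 := by rintro rfl; exact hl (by rw [← hab, zero_mul])
  have ha0' : a' ≠ 0 := by rintro rfl; exact hl (by rw [← hab', zero_mul])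
  have haa : a = a' := Nat.eq_of_factorization_eq ha0 ha0' fun p => by
    rw [factorization_eq_of_split hl hab ha hb, factorization_eq_of_split hl hab' ha' hb']
  refine ⟨haa, ?_⟩
  have h2 : a * b = a * b' := by rw [hab, haa, hab']
  exact mul_left_cancel₀ ha0 h2

/-- The `S`-free part of a splitting is coprime to every `S`-factored number ("`(r, d₁d₂k) = 1`",
§7 p. 40). [cite: Zhang2022LandauSiegel, §7 p.40, tex L2100] -/
theorem coprime_of_split {a' b : ℕ} (hb : ∀ q ∈ S, q.Prime → ¬ q ∣ b)
    (ha' : a' ∈ Nat.factoredNumbers S) : Nat.Coprime b a' := by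
  refine Nat.coprime_of_dvd fun k hk hkb hka => ?_
  exact hb k (Nat.mem_factoredNumbers'.mp ha' k hk hka) hk hkb

/-- The `S`-free part of a splitting is coprime to every `d ≠ 0` whose prime factors lie in `S`
("`(r, d₁d₂k) = 1`", §7 p. 40). [cite: Zhang2022LandauSiegel, §7 p.40, tex L2100] -/
theorem coprime_of_split' {b d : ℕ} (hb : ∀ q ∈ S, q.Prime → ¬ q ∣ b) (hd : d ≠ 0)
    (hdS : d.primeFactors ⊆ S) : Nat.Coprime b d :=
  coprime_of_split hb (Nat.mem_factoredNumbers_iff_primeFactors_subset.mpr ⟨hd, hdS⟩)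

/-! ### §2. Dirichlet convolution of an `S`-supported and an `S`-free sequence -/

/-- **The splitting at the level of Dirichlet convolution.** If `A` is supported on `S`-factored
numbers and `B` vanishes on every number divisible by a prime of `S`, then `(A ∗ B)(l) = A(a)B(b)`
for the splitting `l = ab` of `l ≥ 1` — the mechanism of "Hence `Σ_{(l,kd₂)=1} κ(d₁l)l^{−s} =
κ̃ · λ · ζζζ/ζ`" (§7 p. 40). [cite: Zhang2022LandauSiegel, §7 p.40, tex L2101] -/
theorem convolution_eq_of_split {A B : ℕ → ℂ} (hA : ∀ a, a ∉ Nat.factoredNumbers S → A a = 0)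
    (hB : ∀ b, ∀ q ∈ S, q.Prime → q ∣ b → B b = 0) (hl : l ≠ 0) {a b : ℕ} (hab : a * b = l)
    (ha : a ∈ Nat.factoredNumbers S) (hb : ∀ q ∈ S, q.Prime → ¬ q ∣ b) :
    (A ⍟ B) l = A a * B b := by
  rw [LSeries.convolution_def]
  refine Finset.sum_eq_single (a, b) ?_ ?_
  · rintro ⟨a', b'⟩ hmem hne
    have hab' : a' * b' = l := (Nat.mem_divisorsAntidiagonal.mp hmem).1
    by_cases hAa : a' ∈ Nat.factoredNumbers S
    · by_cases hBb : ∃ q ∈ S, q.Prime ∧ q ∣ b'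
      · obtain ⟨q, hq, hqp, hqb⟩ := hBb
        rw [hB b' q hq hqp hqb, mul_zero]
      · push Not at hBb
        exact absurd (Prod.ext_iff.mpr (split_unique hl hab' hAa hBb hab ha hb)) hne
    · rw [hA a' hAa, zero_mul]
  · intro h
    exact absurd (Nat.mem_divisorsAntidiagonal.mpr ⟨hab, hl⟩) h

/-! ### §3. Local factors at a prime -/

section Local

/-- `(q^e)^s = (q^s)^e` for naturals `q, e` and complex `s`. [folklore] -/
private theorem natCast_pow_cpow (q e : ℕ) (s : ℂ) : ((q ^ e : ℕ) : ℂ) ^ s = ((q : ℂ) ^ s) ^ e := by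
  induction e with
  | zero => simp
  | succ e ih => rw [pow_succ, Nat.cast_mul, Complex.natCast_mul_natCast_cpow, ih, pow_succ]

variable {q : ℕ} {x : ℂ}

/-- At a prime, the local series `Σ_e (f ∗ g)(q^e)x^e` of a Dirichlet convolution is the product of
the local series (Cauchy product; `(f ∗ g)(q^e) = Σ_{i ≤ e} f(q^i)g(q^{e−i})`). [folklore] -/
private theorem tsum_prime_pow_mul (f g : ArithmeticFunction ℂ) (hq : q.Prime)
    (hf : Summable fun e : ℕ => ‖f (q ^ e) * x ^ e‖)
    (hg : Summable fun e : ℕ => ‖g (q ^ e) * x ^ e‖) :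
    ∑' e : ℕ, (f * g) (q ^ e) * x ^ e = (∑' e : ℕ, f (q ^ e) * x ^ e) * ∑' e : ℕ, g (q ^ e) * x ^ e := by
  rw [tsum_mul_tsum_eq_tsum_sum_range_of_summable_norm hf hg]
  refine tsum_congr fun n => ?_
  rw [RankinEisenstein.mul_apply_prime_pow f g hq n, Finset.sum_mul]
  refine Finset.sum_congr rfl fun i hi => ?_
  have hin : i ≤ n := Nat.lt_succ_iff.mp (Finset.mem_range.mp hi)
  rw [show x ^ n = x ^ i * x ^ (n - i) by rw [← pow_add, Nat.add_sub_cancel' hin]]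
  ring

/-- Absolute convergence of the local series of a convolution. [folklore] -/
private theorem summable_prime_pow_mul (f g : ArithmeticFunction ℂ) (hq : q.Prime)
    (hf : Summable fun e : ℕ => ‖f (q ^ e) * x ^ e‖)
    (hg : Summable fun e : ℕ => ‖g (q ^ e) * x ^ e‖) :
    Summable fun e : ℕ => ‖(f * g) (q ^ e) * x ^ e‖ := by
  refine (summable_norm_sum_mul_range_of_summable_norm hf hg).congr fun n => ?_
  congr 1
  rw [RankinEisenstein.mul_apply_prime_pow f g hq n, Finset.sum_mul]
  refine Finset.sum_congr rfl fun i hi => ?_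
  have hin : i ≤ n := Nat.lt_succ_iff.mp (Finset.mem_range.mp hi)
  rw [show x ^ n = x ^ i * x ^ (n - i) by rw [← pow_add, Nat.add_sub_cancel' hin]]
  ring

/-- `n^{−ib}` at a prime power: `powI b (q^e) = (q^{−ib})^e`. [folklore] -/
private theorem powI_prime_pow (b : ℝ) (hq : q.Prime) (e : ℕ) :
    MeanSquareMajorant.powI b (q ^ e) = ((q : ℂ) ^ (-(b * I))) ^ e := by
  rw [MeanSquareMajorant.powI_apply_of_ne_zero b (pow_ne_zero e hq.ne_zero), natCast_pow_cpow]

/-- `‖q^{−ib} x‖ = ‖x‖` (`q ≥ 1`). [folklore] -/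
private theorem norm_cpow_negI_mul (b : ℝ) (hq : q.Prime) (x : ℂ) :
    ‖(q : ℂ) ^ (-(b * I)) * x‖ = ‖x‖ := by
  rw [norm_mul, ← MeanSquareMajorant.powI_apply_of_ne_zero b hq.ne_zero,
    MeanSquareMajorant.norm_powI_of_pos b hq.pos, one_mul]

/-- The local series of `n^{−ib}` is geometric: `Σ_e q^{−ieb}x^e = (1 − q^{−ib}x)⁻¹` for `‖x‖ < 1`.
[folklore] -/
private theorem tsum_prime_pow_powI (b : ℝ) (hq : q.Prime) (hx : ‖x‖ < 1) :
    ∑' e : ℕ, MeanSquareMajorant.powI b (q ^ e) * x ^ e = (1 - (q : ℂ) ^ (-(b * I)) * x)⁻¹ := by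
  have h : ∀ e : ℕ, MeanSquareMajorant.powI b (q ^ e) * x ^ e = ((q : ℂ) ^ (-(b * I)) * x) ^ e :=
    fun e => by rw [powI_prime_pow b hq, mul_pow]
  rw [tsum_congr h]
  exact tsum_geometric_of_norm_lt_one (by rwa [norm_cpow_negI_mul b hq])

/-- Absolute convergence of the local series of `n^{−ib}` for `‖x‖ < 1`. [folklore] -/
private theorem summable_prime_pow_powI (b : ℝ) (hq : q.Prime) (hx : ‖x‖ < 1) :
    Summable fun e : ℕ => ‖MeanSquareMajorant.powI b (q ^ e) * x ^ e‖ := by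
  have h : ∀ e : ℕ, ‖MeanSquareMajorant.powI b (q ^ e) * x ^ e‖ = ‖x‖ ^ e := fun e => by
    rw [powI_prime_pow b hq, ← mul_pow, norm_pow, norm_cpow_negI_mul b hq]
  simp_rw [h]
  exact summable_geometric_of_lt_one (norm_nonneg _) hx

/-- The local series of the Möbius function: `Σ_e μ(q^e)x^e = 1 − x`. [folklore] -/
private theorem tsum_prime_pow_moebius (hq : q.Prime) (x : ℂ) :
    ∑' e : ℕ, (ArithmeticFunction.moebius : ArithmeticFunction ℂ) (q ^ e) * x ^ e = 1 - x := by
  rw [tsum_eq_sum (s := Finset.range 2)]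
  · rw [Finset.sum_range_succ, Finset.sum_range_one, pow_zero, pow_one, pow_zero, pow_one,
      ArithmeticFunction.intCoe_apply, ArithmeticFunction.intCoe_apply,
      ArithmeticFunction.moebius_apply_one, ArithmeticFunction.moebius_apply_prime hq]
    push_cast
    ring
  · intro e he
    have he2 : 2 ≤ e := by
      by_contra hcon
      exact he (Finset.mem_range.mpr (by omega))
    rw [ArithmeticFunction.intCoe_apply,
      ArithmeticFunction.moebius_apply_prime_pow hq (by omega : e ≠ 0), if_neg (by omega : e ≠ 1)]
    simp

/-- Absolute convergence of the (finite) local series of `μ`. [folklore] -/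
private theorem summable_prime_pow_moebius (hq : q.Prime) (x : ℂ) :
    Summable fun e : ℕ => ‖(ArithmeticFunction.moebius : ArithmeticFunction ℂ) (q ^ e) * x ^ e‖ := by
  refine summable_of_ne_finset_zero (s := Finset.range 2) fun e he => ?_
  have he2 : 2 ≤ e := by
    by_contra hcon
    exact he (Finset.mem_range.mpr (by omega))
  rw [ArithmeticFunction.intCoe_apply,
    ArithmeticFunction.moebius_apply_prime_pow hq (by omega : e ≠ 0), if_neg (by omega : e ≠ 1)]
  simp

/-- **The local Euler factor of `κ`**: for `‖x‖ < 1`,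
`Σ_e κ(q^e) x^e = (1 − q^{−ib₁}x)⁻¹(1 − q^{−ib₂}x)⁻¹(1 − q^{−ib₃}x)⁻¹(1 − x)`
(`κ = n^{−ib₁} ∗ n^{−ib₂} ∗ n^{−ib₃} ∗ μ`, `Σ_n κ(n)n^{−s} = ζ(s+β₁)ζ(s+β₂)ζ(s+β₃)/ζ(s)`).
[cite: Zhang2022LandauSiegel, §7 p.34, tex L1868] -/
theorem tsum_prime_pow_kappa (b₁ b₂ b₃ : ℝ) (hq : q.Prime) (hx : ‖x‖ < 1) :
    ∑' e : ℕ, MeanSquareMajorant.kappa b₁ b₂ b₃ (q ^ e) * x ^ e =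
      (1 - (q : ℂ) ^ (-(b₁ * I)) * x)⁻¹ * (1 - (q : ℂ) ^ (-(b₂ * I)) * x)⁻¹ *
        (1 - (q : ℂ) ^ (-(b₃ * I)) * x)⁻¹ * (1 - x) := by
  have h1 := summable_prime_pow_powI b₁ hq hx
  have h2 := summable_prime_pow_powI b₂ hq hx
  have h3 := summable_prime_pow_powI b₃ hq hx
  have hμ := summable_prime_pow_moebius hq x
  have h12 := summable_prime_pow_mul _ _ hq h1 h2
  have h123 := summable_prime_pow_mul _ _ hq h12 h3
  unfold MeanSquareMajorant.kappa
  rw [tsum_prime_pow_mul _ _ hq h123 hμ, tsum_prime_pow_mul _ _ hq h12 h3,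
    tsum_prime_pow_mul _ _ hq h1 h2, tsum_prime_pow_powI b₁ hq hx, tsum_prime_pow_powI b₂ hq hx,
    tsum_prime_pow_powI b₃ hq hx, tsum_prime_pow_moebius hq x]

end Local

end Literature.NumberTheory.LFunctions.Zhang2022.KappaEuler
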